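import Summits.HodgeConjecture.CorCM.Census.QuarticTwistModel

/-!
# The quartic twist `(ℤ/4 × B, (2,0))`, II: face classes, the Lee potential, regimes (unique for `|B|` odd)

COR-CM (cell `pub-hodgecm2`), count-neutral kernel combinatorics by the binder seat b09 (gen 32; lane QUARTIC-TWIST), part II, sequel of
`Census/QuarticTwistModel.lean`.  Bookkeeping definitions + theorems; no `decide` table (only closed `ℤ/4`-trivia by `decide`), no
certificate, no named fact, no geometry, no `sorry`.  HONEST FRAMING: `HC_CM` is NOT proved; nothing here is a headline or a period.

CONTENT.
* §1 **Face classes.**  The rank-four face `(s; p, q)` of the type `s` at two distinct places `p ≠ q` has the four corners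
  `s, s^{(p)}, s^{(q)}, s^{(p,q)}` (`flip`); its class `faceVec s p q = e_s − e_{s^{(p)}} − e_{s^{(q)}} + e_{s^{(p,q)}}` is a Hodge vector
  (`faceVec_mem`: in a column carrying one of the places the four values are `x, x ± 1, x, x ± 1` (cross square) or `x, x+1, x−1, x+2`
  (column face) and the Pohlmann forms cancel; elsewhere the four corners agree); Galois translates of face classes are face classes
  (`transl_faceVec`); `spanFaces S = ℤ⟨all translates of the classes of S⟩` is `G`-stable and `≤ H`.
* §2 **The Lee potential** `L u s = Σ_b Lee(s b − u)` (`Lee = 0,1,2,1`), `Φ s = min_u L u s`, invariant under the action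
  (`L_tw`, `Phi_tw`); a `±1` move at one column changes every `L u` by exactly `1` (`L_move`).
* §3 **Regimes for `|B|` odd.**  `L u + L (u+1) ≡ |B| (mod 2)` and `L u + L (u+2) = 2|B|` force a UNIQUE minimising regime
  `reg s` (`reg_unique`), equivariant (`reg_tw`); a `Φ`-decreasing `±1` move at a column keeps the regime and lowers `L (reg s)` by one
  (`reg_move`, `L_reg_move`) — it is a move TOWARD the regime.
All [folklore].

## References
* [Pohlmann1968] H. Pohlmann, Algebraic cycles on abelian varieties of complex multiplication type, Ann. of Math. 88 (1968), Thm 1.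
-/

namespace Summit.HodgeConjecture.CorCM.Census.QuarticTwist

open Finset

variable (B : Type) [AddGroup B] [Fintype B] [DecidableEq B]

/-! ## §1 Face classes -/

/-- **The face class** of the rank-four face `(s; p, q)`: `e_s − e_{s^{(p)}} − e_{s^{(q)}} + e_{s^{(p,q)}}`. [folklore] -/
def faceVec (s : Ty B) (p q : ZMod 2 × B) : Ty B → ℤ :=
  Pi.single s 1 - Pi.single (flip B p s) 1 - Pi.single (flip B q s) 1 + Pi.single (flip B q (flip B p s)) 1

omit [AddGroup B] [Fintype B] [DecidableEq B] in
/-- The Pohlmann coefficient of `(a, t)` depends only on the value of the type at `t`. [folklore] -/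
theorem coef_congr {g : ZMod 4 × B} {s s' : Ty B} (h : s g.2 = s' g.2) : coef B g s = coef B g s' := by
  unfold coef; rw [h]

omit [AddGroup B] in
/-- The form of `g` on a face class. [folklore] -/
theorem coef_dotProduct_faceVec (g : ZMod 4 × B) (s : Ty B) (p q : ZMod 2 × B) :
    coef B g ⬝ᵥ faceVec B s p q =
      coef B g s - coef B g (flip B p s) - coef B g (flip B q s) + coef B g (flip B q (flip B p s)) := by
  unfold faceVec
  rw [dotProduct_add, dotProduct_sub, dotProduct_sub, dotProduct_single, dotProduct_single, dotProduct_single, dotProduct_single]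
  ring

/-- The second place of a column steps the other way: `step (j + 1) x = − step j x`. [folklore] -/
theorem step_succ (j : ZMod 2) (x : ZMod 4) : step (j + 1) x = -step j x := by
  have key : ∀ (j : ZMod 2) (x : ZMod 4), (if par x = j + 1 then (1 : ZMod 4) else -1) = -(if par x = j then 1 else -1) := by decide
  exact key j x

/-- The column Pohlmann forms cancel on the four values `x, x + e, x − e, x + 2` (`e = ±1`). [folklore] -/
theorem coef_column_cancel (a x e : ZMod 4) (he : e = 1 ∨ e = -1) :
    (if a = x ∨ a = x + 1 then (1 : ℤ) else -1) - (if a = x + e ∨ a = x + e + 1 then (1 : ℤ) else -1)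
      - (if a = x + -e ∨ a = x + -e + 1 then (1 : ℤ) else -1) + (if a = x + 2 ∨ a = x + 2 + 1 then (1 : ℤ) else -1) = 0 := by
  have key : ∀ a x : ZMod 4, (if a = x ∨ a = x + 1 then (1 : ℤ) else -1) - (if a = x + 1 ∨ a = x + 1 + 1 then (1 : ℤ) else -1)
      - (if a = x + -1 ∨ a = x + -1 + 1 then (1 : ℤ) else -1) + (if a = x + 2 ∨ a = x + 2 + 1 then (1 : ℤ) else -1) = 0 := by decide
  rcases he with rfl | rfl
  · exact key a x
  · have := key a x; rw [neg_neg]; linarith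

omit [AddGroup B] in
/-- **Face classes are Hodge vectors** (`p ≠ q`). [folklore] -/
theorem faceVec_mem (s : Ty B) {p q : ZMod 2 × B} (hpq : p ≠ q) : faceVec B s p q ∈ hodge B := by
  intro g
  rw [coef_dotProduct_faceVec]
  by_cases hcol : p.2 = q.2
  · -- column face: `q = (p.1 + 1, p.2)`
    have hq1 : q.1 = p.1 + 1 := by
      have hne : q.1 ≠ p.1 := fun h => hpq (Prod.ext h.symm hcol)
      have key : ∀ j j' : ZMod 2, j' ≠ j → j' = j + 1 := by decide
      exact key _ _ hne
    have hq : q = (p.1 + 1, p.2) := Prod.ext hq1 hcol.symm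
    by_cases ht : g.2 = p.2
    · -- the form sits in the column of the face
      have e1 : coef B g s = (if g.1 = s p.2 ∨ g.1 = s p.2 + 1 then 1 else -1) := by unfold coef; rw [ht]
      have e2 : coef B g (flip B p s) = (if g.1 = s p.2 + step p.1 (s p.2) ∨ g.1 = s p.2 + step p.1 (s p.2) + 1 then 1 else -1) := by
        unfold coef; rw [ht, flip_apply_self]
      have e3 : coef B g (flip B q s) = (if g.1 = s p.2 + -step p.1 (s p.2) ∨ g.1 = s p.2 + -step p.1 (s p.2) + 1 then 1 else -1) := by
        unfold coef; rw [ht, hq, show ((p.1 + 1, p.2) : ZMod 2 × B).2 = p.2 from rfl, flip_apply_self, step_succ]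
      have e4 : coef B g (flip B q (flip B p s)) = (if g.1 = s p.2 + 2 ∨ g.1 = s p.2 + 2 + 1 then 1 else -1) := by
        unfold coef
        rw [ht, hq, show p = (p.1, p.2) from rfl, flip_flip_same, Pi.add_apply, Pi.single_eq_same]
      rw [e1, e2, e3, e4]
      exact coef_column_cancel _ _ _ (step_eq_or _ _)
    · -- the form sits elsewhere: all four corners agree at `g.2`
      have htq : g.2 ≠ q.2 := fun h => ht (h.trans hcol.symm)
      rw [coef_congr B (s := flip B p s) (s' := s) (flip_apply_of_ne B p s ht),
        coef_congr B (s := flip B q s) (s' := s) (flip_apply_of_ne B q s htq),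
        coef_congr B (s := flip B q (flip B p s)) (s' := s)
          (by rw [flip_apply_of_ne B q _ htq, flip_apply_of_ne B p s ht])]
      ring
  · -- cross square
    by_cases ht : g.2 = p.2
    · have htq : g.2 ≠ q.2 := fun h => hcol (ht.symm.trans h)
      rw [coef_congr B (s := flip B q s) (s' := s) (flip_apply_of_ne B q s htq),
        coef_congr B (s := flip B q (flip B p s)) (s' := flip B p s) (flip_apply_of_ne B q _ htq)]
      ring
    · rw [coef_congr B (s := flip B p s) (s' := s) (flip_apply_of_ne B p s ht),
        coef_congr B (s := flip B q (flip B p s)) (s' := flip B q s)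
          (by rw [flip_comm B p q hcol, flip_apply_of_ne B p _ ht])]
      ring

/-- The place map of a twist `g = (v, t)`: `(j, b) ↦ (j + par v, b − t)`. [folklore] -/
def plc (g : ZMod 4 × B) (p : ZMod 2 × B) : ZMod 2 × B := (p.1 + par g.1, p.2 - g.2)

omit [Fintype B] [DecidableEq B] in
/-- `plc g` is injective. [folklore] -/
theorem plc_injective (g : ZMod 4 × B) : Function.Injective (plc B g) := by
  intro p q h
  simp only [plc, Prod.mk.injEq] at h
  exact Prod.ext (add_right_cancel h.1) (sub_left_injective h.2)

/-- **A Galois translate of a face class is the face class of the translated face.** [folklore] -/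
theorem transl_faceVec (g : ZMod 4 × B) (s : Ty B) (p q : ZMod 2 × B) :
    transl B g (faceVec B s p q) = faceVec B (tw B g s) (plc B g p) (plc B g q) := by
  unfold faceVec plc
  rw [transl_add, transl_sub, transl_sub, transl_single, transl_single, transl_single, transl_single, tw_flip, tw_flip, tw_flip, tw_flip]

/-- **The span of all Galois translates** of the classes of a family of faces `S`. [folklore] -/
def spanFaces (S : Finset (Ty B × (ZMod 2 × B) × (ZMod 2 × B))) : Submodule ℤ (Ty B → ℤ) :=
  Submodule.span ℤ {v | ∃ g : ZMod 4 × B, ∃ f ∈ S, v = transl B g (faceVec B f.1 f.2.1 f.2.2)}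

/-- Monotonicity of `spanFaces`. [folklore] -/
theorem spanFaces_mono {S T : Finset (Ty B × (ZMod 2 × B) × (ZMod 2 × B))} (h : S ⊆ T) : spanFaces B S ≤ spanFaces B T := by
  refine Submodule.span_mono ?_
  rintro v ⟨g, f, hf, rfl⟩
  exact ⟨g, f, h hf, rfl⟩

/-- `spanFaces S ≤ H` when every face of `S` has two distinct places. [folklore] -/
theorem spanFaces_le_hodge {S : Finset (Ty B × (ZMod 2 × B) × (ZMod 2 × B))} (h : ∀ f ∈ S, f.2.1 ≠ f.2.2) :
    spanFaces B S ≤ hodge B := by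
  refine Submodule.span_le.mpr ?_
  rintro v ⟨g, f, hf, rfl⟩
  exact transl_mem B (faceVec_mem B f.1 (h f hf)) g

/-- The class of a member face lies in `spanFaces S`. [folklore] -/
theorem faceVec_mem_spanFaces {S : Finset (Ty B × (ZMod 2 × B) × (ZMod 2 × B))} {f : Ty B × (ZMod 2 × B) × (ZMod 2 × B)}
    (hf : f ∈ S) : faceVec B f.1 f.2.1 f.2.2 ∈ spanFaces B S :=
  Submodule.subset_span ⟨0, f, hf, by rw [transl_zero]⟩

/-- A translate of the class of a member face lies in `spanFaces S`. [folklore] -/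
theorem transl_faceVec_mem_spanFaces {S : Finset (Ty B × (ZMod 2 × B) × (ZMod 2 × B))} {f : Ty B × (ZMod 2 × B) × (ZMod 2 × B)}
    (hf : f ∈ S) (g : ZMod 4 × B) : transl B g (faceVec B f.1 f.2.1 f.2.2) ∈ spanFaces B S :=
  Submodule.subset_span ⟨g, f, hf, rfl⟩

omit [Fintype B] [DecidableEq B] in
/-- Translating twice. [folklore] -/
theorem transl_transl (g h : ZMod 4 × B) (v : Ty B → ℤ) : transl B g (transl B h v) = transl B (g + h) v := by
  funext s
  simp only [transl]
  rw [tw_tw, neg_add_rev]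

/-- **`spanFaces S` is `G`-stable.** [folklore] -/
theorem transl_mem_spanFaces {S : Finset (Ty B × (ZMod 2 × B) × (ZMod 2 × B))} {v : Ty B → ℤ} (hv : v ∈ spanFaces B S)
    (g : ZMod 4 × B) : transl B g v ∈ spanFaces B S := by
  unfold spanFaces at hv ⊢
  induction hv using Submodule.span_induction with
  | mem x hx =>
    obtain ⟨h, f, hf, rfl⟩ := hx
    rw [transl_transl]
    exact Submodule.subset_span ⟨g + h, f, hf, rfl⟩
  | zero => exact Submodule.zero_mem _
  | add x y _ _ hx hy => rw [transl_add]; exact Submodule.add_mem _ hx hy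
  | smul a x _ hx => rw [transl_smul]; exact Submodule.smul_mem _ a hx

/-- **`P ⊔ spanFaces S` is `G`-stable.** [folklore] -/
theorem transl_mem_sup {S : Finset (Ty B × (ZMod 2 × B) × (ZMod 2 × B))} {v : Ty B → ℤ} (hv : v ∈ pairs B ⊔ spanFaces B S)
    (g : ZMod 4 × B) : transl B g v ∈ pairs B ⊔ spanFaces B S := by
  obtain ⟨x, hx, y, hy, rfl⟩ := Submodule.mem_sup.mp hv
  rw [transl_add]
  exact Submodule.add_mem _ (Submodule.mem_sup_left (transl_mem_pairs B hx g)) (Submodule.mem_sup_right (transl_mem_spanFaces B hy g))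

/-! ## §2 The Lee potential -/

/-- The Lee weight on `ℤ/4`: `0, 1, 2, 1`. [folklore] -/
def lee (x : ZMod 4) : ℕ := if x = 0 then 0 else if x = 2 then 2 else 1

/-- `Lee(x) + Lee(x − 1)` is odd: it is `2k + 1` with `k = (Lee x + Lee (x−1))/2`. [folklore] -/
theorem lee_add_lee_sub_one (x : ZMod 4) : lee x + lee (x - 1) = 2 * ((lee x + lee (x - 1)) / 2) + 1 := by
  revert x; decide

/-- `Lee(x) + Lee(x − 2) = 2`. [folklore] -/
theorem lee_add_lee_sub_two (x : ZMod 4) : lee x + lee (x - 2) = 2 := by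
  revert x; decide

/-- A `±1` step changes the Lee weight by exactly one. [folklore] -/
theorem lee_step (x e : ZMod 4) (he : e = 1 ∨ e = -1) : lee (x + e) + 1 = lee x ∨ lee (x + e) = lee x + 1 := by
  have k1 : ∀ x : ZMod 4, lee (x + 1) + 1 = lee x ∨ lee (x + 1) = lee x + 1 := by decide
  have k3 : ∀ x : ZMod 4, lee (x + -1) + 1 = lee x ∨ lee (x + -1) = lee x + 1 := by decide
  rcases he with rfl | rfl
  · exact k1 x
  · exact k3 x

/-- `Lee ≤ 2`. [folklore] -/
theorem lee_le_two (x : ZMod 4) : lee x ≤ 2 := by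
  revert x; decide

/-- `Lee x = 0 ↔ x = 0`. [folklore] -/
theorem lee_eq_zero_iff (x : ZMod 4) : lee x = 0 ↔ x = 0 := by
  revert x; decide

/-- **The Lee potential of `s` relative to the regime `u`**: `L u s = Σ_b Lee(s b − u)`. [folklore] -/
def L (u : ZMod 4) (s : Ty B) : ℕ := ∑ b, lee (s b - u)

/-- **The Lee potential** `Φ s = min_u L u s`. [folklore] -/
def Phi (s : Ty B) : ℕ := (univ.image fun u => L B u s).min' ((univ_nonempty.image _))

omit [AddGroup B] [DecidableEq B] in
/-- `Φ s ≤ L u s`. [folklore] -/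
theorem Phi_le (u : ZMod 4) (s : Ty B) : Phi B s ≤ L B u s :=
  Finset.min'_le _ _ (mem_image_of_mem _ (mem_univ u))

omit [AddGroup B] [DecidableEq B] in
/-- The potential is attained. [folklore] -/
theorem exists_L_eq_Phi (s : Ty B) : ∃ u, L B u s = Phi B s := by
  have h := Finset.min'_mem (univ.image fun u => L B u s) (univ_nonempty.image _)
  obtain ⟨u, -, hu⟩ := mem_image.mp h
  exact ⟨u, hu⟩

omit [DecidableEq B] in
/-- The potential relative to `u` of a twist by `(v, t)` is the potential relative to `u − v`. [folklore] -/
theorem L_tw (g : ZMod 4 × B) (u : ZMod 4) (s : Ty B) : L B u (tw B g s) = L B (u - g.1) s := by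
  unfold L tw
  refine Fintype.sum_equiv (Equiv.addRight g.2) _ _ ?_
  intro b
  simp only [Equiv.coe_addRight]
  congr 1
  ring

omit [DecidableEq B] in
/-- **`Φ` is invariant under the action.** [folklore] -/
theorem Phi_tw (g : ZMod 4 × B) (s : Ty B) : Phi B (tw B g s) = Phi B s := by
  unfold Phi
  congr 1
  ext k
  simp only [mem_image, mem_univ, true_and, L_tw]
  constructor
  · rintro ⟨u, hu⟩; exact ⟨u - g.1, hu⟩
  · rintro ⟨u, hu⟩; exact ⟨u + g.1, by rw [add_sub_cancel_right]; exact hu⟩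

omit [AddGroup B] in
/-- Splitting the potential at a column. [folklore] -/
theorem L_eq_add_erase (u : ZMod 4) (s : Ty B) (b : B) : L B u s = lee (s b - u) + ∑ x ∈ univ.erase b, lee (s x - u) := by
  unfold L
  rw [← Finset.add_sum_erase _ _ (mem_univ b)]

omit [AddGroup B] in
/-- **A `±1` move at one column changes every `L u` by exactly one.** [folklore] -/
theorem L_move (u : ZMod 4) (s : Ty B) (b : B) (e : ZMod 4) (he : e = 1 ∨ e = -1) :
    L B u (s + Pi.single b e) + 1 = L B u s ∨ L B u (s + Pi.single b e) = L B u s + 1 := by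
  have h1 := L_eq_add_erase B u (s + Pi.single b e : Ty B) b
  have h2 := L_eq_add_erase B u s b
  have hrest : ∑ x ∈ univ.erase b, lee ((s + Pi.single b e : Ty B) x - u) = ∑ x ∈ univ.erase b, lee (s x - u) := by
    refine Finset.sum_congr rfl ?_
    intro x hx
    rw [Pi.add_apply, Pi.single_eq_of_ne (ne_of_mem_erase hx), add_zero]
  rw [hrest, Pi.add_apply, Pi.single_eq_same] at h1
  have h := lee_step (s b - u) e he
  rw [show s b + e - u = s b - u + e by ring] at h1
  omega

omit [AddGroup B] in
/-- A move changes `Φ` by at most one downwards: `Φ s ≤ Φ (s + e·δ_b) + 1`. [folklore] -/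
theorem Phi_le_Phi_move_add_one (s : Ty B) (b : B) (e : ZMod 4) (he : e = 1 ∨ e = -1) :
    Phi B s ≤ Phi B (s + Pi.single b e) + 1 := by
  obtain ⟨u, hu⟩ := exists_L_eq_Phi B (s + Pi.single b e)
  have h := L_move B u s b e he
  have := Phi_le B u s
  omega

/-! ## §3 Regimes: for `|B|` odd the minimising regime is unique -/

omit [AddGroup B] [DecidableEq B] in
/-- `L u s + L (u + 1) s = 2K + |B|`. [folklore] -/
theorem L_add_L_succ (u : ZMod 4) (s : Ty B) : ∃ K : ℕ, L B u s + L B (u + 1) s = 2 * K + Fintype.card B := by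
  refine ⟨∑ b, (lee (s b - u) + lee (s b - u - 1)) / 2, ?_⟩
  unfold L
  have h : ∀ b, lee (s b - u) + lee (s b - (u + 1)) = 2 * ((lee (s b - u) + lee (s b - u - 1)) / 2) + 1 := fun b => by
    rw [show s b - (u + 1) = s b - u - 1 by ring]
    exact lee_add_lee_sub_one _
  rw [← Finset.sum_add_distrib, Finset.sum_congr rfl (fun b _ => h b), Finset.sum_add_distrib, ← Finset.mul_sum]
  simp

omit [AddGroup B] [DecidableEq B] in
/-- `L u s + L (u + 2) s = 2|B|`. [folklore] -/
theorem L_add_L_add_two (u : ZMod 4) (s : Ty B) : L B u s + L B (u + 2) s = 2 * Fintype.card B := by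
  unfold L
  rw [← Finset.sum_add_distrib, ← Finset.card_univ, Finset.card_eq_sum_ones, Finset.mul_sum]
  refine Finset.sum_congr rfl ?_
  intro b _
  rw [show s b - (u + 2) = s b - u - 2 by ring, lee_add_lee_sub_two, mul_one]

omit [AddGroup B] [DecidableEq B] in
/-- **Uniqueness of the minimising regime** (`|B|` odd). [folklore] -/
theorem reg_unique (hB : Odd (Fintype.card B)) {s : Ty B} {u u' : ZMod 4} (hu : L B u s = Phi B s) (hu' : L B u' s = Phi B s) :
    u = u' := by
  -- adjacent regimes cannot both minimise (parity), opposite regimes cannot both minimise (sum `2|B|`)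
  have hadj : ∀ w : ZMod 4, L B w s = Phi B s → L B (w + 1) s = Phi B s → False := by
    intro w h1 h2
    obtain ⟨K, hK⟩ := L_add_L_succ B w s
    obtain ⟨m, hm⟩ := hB
    omega
  have hopp : ∀ w : ZMod 4, L B w s = Phi B s → L B (w + 2) s = Phi B s → False := by
    intro w h1 h2
    have h3 := L_add_L_add_two B w s
    have h4 := L_add_L_add_two B (w + 1) s
    rw [show w + 1 + 2 = w + 3 by ring] at h4
    have h5 := Phi_le B (w + 1) s
    have h6 := Phi_le B (w + 3) s
    have h7 : L B (w + 1) s = Phi B s := by omega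
    exact hadj w h1 h7
  have key : ∀ a b : ZMod 4, a = b ∨ b = a + 1 ∨ b = a + 2 ∨ a = b + 1 := by decide
  rcases key u u' with h | h | h | h
  · exact h
  · exact (hadj u hu (h ▸ hu')).elim
  · exact (hopp u hu (h ▸ hu')).elim
  · exact (hadj u' hu' (h ▸ hu)).elim

/-- **The regime** of a type: the first `u` attaining `Φ`. [folklore] -/
def reg (s : Ty B) : ZMod 4 :=
  if L B 0 s = Phi B s then 0 else if L B 1 s = Phi B s then 1 else if L B 2 s = Phi B s then 2 else 3

omit [AddGroup B] [DecidableEq B] in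
/-- The regime attains the potential. [folklore] -/
theorem L_reg (s : Ty B) : L B (reg B s) s = Phi B s := by
  obtain ⟨u, hu⟩ := exists_L_eq_Phi B s
  unfold reg
  split_ifs with h0 h1 h2
  · exact h0
  · exact h1
  · exact h2
  · have key : ∀ u : ZMod 4, u = 0 ∨ u = 1 ∨ u = 2 ∨ u = 3 := by decide
    rcases key u with rfl | rfl | rfl | rfl
    · exact (h0 hu).elim
    · exact (h1 hu).elim
    · exact (h2 hu).elim
    · exact hu

omit [AddGroup B] [DecidableEq B] in
/-- **A minimising regime is THE regime** (`|B|` odd). [folklore] -/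
theorem eq_reg_of_L_eq (hB : Odd (Fintype.card B)) {s : Ty B} {u : ZMod 4} (hu : L B u s = Phi B s) : u = reg B s :=
  reg_unique B hB hu (L_reg B s)

omit [AddGroup B] [DecidableEq B] in
/-- A non-regime has potential at least `Φ + 1` (`|B|` odd). [folklore] -/
theorem Phi_lt_L_of_ne_reg (hB : Odd (Fintype.card B)) {s : Ty B} {u : ZMod 4} (hu : u ≠ reg B s) : Phi B s + 1 ≤ L B u s := by
  have h1 := Phi_le B u s
  rcases Nat.lt_or_ge (Phi B s) (L B u s) with h | h
  · exact h
  · exact absurd (eq_reg_of_L_eq B hB (le_antisymm h h1)) hu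

omit [DecidableEq B] in
/-- **The regime is equivariant**: `reg (tw (v,t) s) = reg s + v` (`|B|` odd). [folklore] -/
theorem reg_tw (hB : Odd (Fintype.card B)) (g : ZMod 4 × B) (s : Ty B) : reg B (tw B g s) = reg B s + g.1 := by
  symm
  refine eq_reg_of_L_eq B hB ?_
  rw [L_tw, add_sub_cancel_right, Phi_tw, L_reg]

omit [AddGroup B] in
/-- **A `Φ`-decreasing move keeps the regime and is a move toward it** (`|B|` odd): for `e = ±1` with `Φ (s + e·δ_b) < Φ s`,
`reg (s + e·δ_b) = reg s` and `L (reg s) (s + e·δ_b) + 1 = L (reg s) s`. [folklore] -/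
theorem reg_move (hB : Odd (Fintype.card B)) (s : Ty B) (b : B) (e : ZMod 4) (he : e = 1 ∨ e = -1)
    (hlt : Phi B (s + Pi.single b e) < Phi B s) :
    reg B (s + Pi.single b e) = reg B s ∧ L B (reg B s) (s + Pi.single b e) + 1 = L B (reg B s) s := by
  have h1 := Phi_le_Phi_move_add_one B s b e he
  have hΦ : Phi B (s + Pi.single b e) + 1 = Phi B s := by omega
  -- the regime `u'` of the moved type minimises for `s` too
  have hL' : L B (reg B (s + Pi.single b e)) (s + Pi.single b e) = Phi B (s + Pi.single b e) := L_reg B _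
  have hmv := L_move B (reg B (s + Pi.single b e)) s b e he
  have hle : L B (reg B (s + Pi.single b e)) s ≤ Phi B s := by omega
  have heq : L B (reg B (s + Pi.single b e)) s = Phi B s := le_antisymm hle (Phi_le B _ s)
  have hreg : reg B (s + Pi.single b e) = reg B s := eq_reg_of_L_eq B hB heq
  refine ⟨hreg, ?_⟩
  rw [← hreg, hL', heq, hΦ]

omit [AddGroup B] in
/-- **The Lee weight at the moved column drops by one** under a `Φ`-decreasing move (`|B|` odd). [folklore] -/
theorem lee_move_of_Phi_lt (hB : Odd (Fintype.card B)) (s : Ty B) (b : B) (e : ZMod 4) (he : e = 1 ∨ e = -1)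
    (hlt : Phi B (s + Pi.single b e) < Phi B s) : lee (s b + e - reg B s) + 1 = lee (s b - reg B s) := by
  have h := (reg_move B hB s b e he hlt).2
  have h1 := L_eq_add_erase B (reg B s) (s + Pi.single b e : Ty B) b
  have h2 := L_eq_add_erase B (reg B s) s b
  have hrest : ∑ x ∈ univ.erase b, lee ((s + Pi.single b e : Ty B) x - reg B s) = ∑ x ∈ univ.erase b, lee (s x - reg B s) := by
    refine Finset.sum_congr rfl ?_
    intro x hx
    rw [Pi.add_apply, Pi.single_eq_of_ne (ne_of_mem_erase hx), add_zero]
  rw [hrest, Pi.add_apply, Pi.single_eq_same] at h1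
  omega

end Summit.HodgeConjecture.CorCM.Census.QuarticTwist
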